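import Summits.HodgeConjecture.HodgeConjecture.Theorems.Ring2HypothesesCMPivot
import Summits.HodgeConjecture.HodgeConjecture.Theorems.Ring2DeformPrintedFamilies
import Summits.HodgeConjecture.HodgeConjecture.Theorems.PadicSemiregularLiftHodgeAbelianVarietiesCMPivotConverseHolds
import Literature.AlgebraicGeometry.Motives.AbelianFibresOfAbelianFibre
import Literature.AlgebraicGeometry.HodgeTheory.IsoTransport
import HarnessLib

/-!
# Ring 2 · route `deform`, XX — the CM-pivot anchor node `CMAnchoredFamilies` TIED to the deform axis's
# printed family inputs: `CMDenseMumfordTateFamilies ⟹ CMAnchoredFamilies ⟹ MumfordTateCMAnchors`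

HONEST FRAMING: research route conditional on HC_CM; not a corollary; Q11.4-sentence-2 already refuted in dim ≥ 3.

Cell `pub-hodge-ring2`, seat `pub-hodge-ring2-deform` (gen 66; rev 2 = docstring-only, gen 87). `HC_CM` is ALWAYS
the explicit hypothesis
`Theses.RankFourFaces.CMAbelianHodge` (tree item stmt-HodgeConjecture-3052) — a binder, never an axiom, never a
cited fact; `HC_AV` is `Theses.PadicSemiregularLift.HodgeAbelianVarieties`; the reduction item is
`Theses.RankFourFaces.CMToAbelian` (stmt-HodgeConjecture-16267, OPEN). Nothing in this file is a case of the Hodge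
conjecture, and no statement minted in this cell is cited as a fact.

## What this part does

The cell's binder ledger (Hodge ladder stage 3, `BINDER-OWNERS.md` row b07, kind CITE: "kernel bridge from the
landed fact not written") asks for the edge tying the CM-pivot's anchor node `Ring2.Hypotheses.CMAnchoredFamilies`
(child 2 of crux `HodgeAbelianVarieties`, line `cm-pivot`: every Hodge class on a complex abelian variety sits in a
smooth projective family over a smooth irreducible base, `𝒳` and `S` QUASI-PROJECTIVE, with a CM fibre in the
EIGENVALUE typing `IsCM[A₀]`) to the refereed literature, and for its relation to the deform axis's one-CM-fibre
node `Ring2.Hypotheses.MumfordTateCMAnchors` (part I; CM fibre in the SUBALGEBRA typing of `HC_CM`; no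
quasi-projectivity clause). This part proves, sorry-free:

* (A) `cmAnchoredFamilies_of_cmDense` — **`Ring2.Deform.CMDenseMumfordTateFamilies ⟹ CMAnchoredFamilies`**,
  FACT-FREE: part II-b's dense node carries the quasi-projectivity of `𝒳`, `S`; density of the CM locus gives one
  CM fibre; the two CM typings agree by the tree's UNCONDITIONAL `isCM_iff_exists_cmSubalgebra` (Mumford §22);
  the fibrewise `(p,p)` clause is moved to every abelian presentation of a fibre by iso-transport.
* (B) `cmAnchoredFamilies_of_deligne1982` — hence **`CMAnchoredFamilies ⟸` the refereed Literature fact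
  `Deligne1982.deligne1982_cmDenseMumfordTateFamilies`** (Deligne 1982 Prop. 6.1 in the dense form of
  Charles–Schnell Thm. 11.5.11; part III's `cmDenseMumfordTateFamilies_iff_deligne1982` is `Iff.rfl`). So the
  CM-pivot's child 2 is a binder DERIVED FROM A CITED LITERATURE FACT ALONE — it is no longer a free input of the
  cell. (The dense fact carries the quasi-projectivity of `𝒳` and `S` — Charles–Schnell, proof of Thm. 11.5.11: "by
  the theorem of Cattani–Deligne–Kaplan, `B` is again a quasi-projective variety"; the one-fibre fact
  `Abdulali1994.deligne1982_exists_cmAnchoredHodgeFamily` does not, which is why (B) goes through the dense fact.)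
* (C) `mumfordTateCMAnchors_of_cmAnchoredFamilies` — **`CMAnchoredFamilies ⟹ MumfordTateCMAnchors` modulo ONE
  printed fact**, `Motives.catanese2002_abelianFibres_of_abelianFibre` (Catanese 2002 Thm. 4.1/4.6: every fibre of
  a smooth projective family through an abelian variety over a smooth irreducible quasi-projective base is an
  abelian variety) — needed because `MumfordTateCMAnchors` demands an abelian chart at EVERY fibre while
  `CMAnchoredFamilies` only constrains the fibres that happen to be presented as abelian varieties.
* (D) the CM pivot with its anchor child DISCHARGED TO PRINT: `hc_av_of_hc_cm_of_localVHCAtCM_of_deligne1982` —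
  **`HC_CM ∧ LocalVHCAtCM ∧ [Deligne 1982 Prop. 6.1, dense form] ⟹ HC_AV`** — and the item-16267 form
  `cmToAbelian_of_localVHCAtCM_of_deligne1982` — **`LocalVHCAtCM ∧ [fact] ⟹ CMToAbelian`**. `HC_CM` is consumed at
  the CM fibre and is not dominated by `LocalVHCAtCM` in the tree (hypotheses layer II, §A); `LocalVHCAtCM` (the
  variational Hodge conjecture as a germ at a CM fibre of an abelian family; row b08, NOT IN PRINT in any form) stays
  OPEN and is the whole residual content of the row.

## Honest column

(1) [rev 2, docstring-only, 2026-08-21 (gen 87), after ring2-b01's p245844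
`Theorems/Ring2HypothesesMTAnchorsAsTyped.lean` (ACCEPTED, commit f7572f84a52c) — rev 1's sentence «the converse is
NOT derivable as typed» is SUPERSEDED in the tree; 0 statements / 0 proofs of this file are touched.] The converse
`MumfordTateCMAnchors ⟹ CMAnchoredFamilies` is not proved IN THIS FILE (the family produced by
`MumfordTateCMAnchors` carries no quasi-projectivity of `𝒳` or `S`, which `CMAnchoredFamilies` demands — its
`QProj[·]` clauses feed the Baire/Chow arguments of `LocalVHCAtCM`'s consumers). It IS derived, modulo the booked
printed fact `Motives.raynaud1970_abelianScheme_section_projective` (Raynaud 1970 XI 1.4; a hypothesis there, not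
discharged), by seat ring2-b01: `Ring2.Hypotheses.cmAnchoredFamilies_of_mumfordTateCMAnchors_of_raynaud1970`
(`Theorems/Ring2HypothesesMTAnchorsAsTyped.lean` :243, via Mumford's two-point curve lemma in its NON-separated
form, the tree theorems `Literature/AlgebraicGeometry/Motives/CurveThroughTwoPoints*.lean`; over separated bases
already `cmAnchoredFamilies_of_mtAnchorsSep_of_raynaud1970`, `Theorems/Ring2HypothesesMTAnchorsCMAnchored.lean`
:335). Hence the two nodes are ONE ROW modulo {Raynaud 1970, Catanese 2002}:
`Ring2.Hypotheses.mumfordTateCMAnchors_iff_cmAnchoredFamilies_of_raynaud1970_of_catanese2002` (ibid. :251) — count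
once ring2-b01. The two-sided statement proved in THIS file stays (A)+(C): `CMDense ⟹ CMAnchored ⟹[Catanese]
MTAnchors`, all three implied by the dense fact (B, part III); road (D) is unaffected (it goes through the dense
fact, which carries the quasi-projectivity).
(2) (D) is a READING of Deligne's reduction with "absolute Hodge" replaced by "algebraic": a research route
conditional on `HC_CM` AND on the open `LocalVHCAtCM`; not a corollary of anything in print; no case of HC is
proved. (3) Net literature debt of this part: 0 new facts (fact #20 and the Catanese fact are already in the tree).

References: [Deligne1982HodgeCycles] Prop. 6.1, §6 pp. 59–61; [CharlesSchnell2014Notes] Conj. 11.3.1, Prop. 11.3.11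
(with proof), Thm. 11.5.11 (with proof); [Catanese2002DeformationTypes] Thm. 4.1, Thm. 4.6; [MumfordAV1970] §19 Thm. 3,
§22; [Mumford1969NoteShimura] §3; [Abdulali1994FamiliesAV] p. 1122.
-/

-- namespace `…Ring2.Deform` as parts I–XIX (the cell's `Summits/HodgeConjecture/Ring2/` is not allowlisted).
set_option linter.dupNamespace false

noncomputable section

namespace Summit.HodgeConjecture.HodgeConjecture.Ring2.Deform

open CategoryTheory AlgebraicGeometry
open Literature.AlgebraicGeometry Literature.AlgebraicGeometry.Motives
open Literature.AlgebraicGeometry.HodgeTheory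
open Literature.AlgebraicGeometry.Deligne1982 (deligne1982_cmDenseMumfordTateFamilies)
open Summit.HodgeConjecture.HodgeConjecture
open Summit.HodgeConjecture.HodgeConjecture.Theses
open Summit.HodgeConjecture.HodgeConjecture.Ring2.Hypotheses (CMAnchoredFamilies LocalVHCAtCM MumfordTateCMAnchors)
open Summit.HodgeConjecture.HodgeConjecture.Theorems.HodgeAbelianVarieties.CMPivot (isCM_iff_exists_cmSubalgebra)

/-! ## §A The dense Mumford–Tate node implies the CM-pivot's anchor node (fact-free) -/

/-- **(A) `CMDenseMumfordTateFamilies ⟹ CMAnchoredFamilies`**, fact-free. Abelian varieties are smooth projective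
(`AbelianVariety.isSmoothProjective_holds`); the dense CM locus of the Mumford–Tate family is non-empty (`S(ℂ) ∋ s₁`),
giving a CM fibre `A₀ ≅ 𝒳_{s₀}` in the subalgebra typing `Milne1999.IsOfCMType`, converted to the eigenvalue typing
`IsCM[A₀]` by the tree's unconditional `isCM_iff_exists_cmSubalgebra`; the presentations `e ≫ ι_{s₁}`, `e₀ ≫ ι_{s₀}`
are fibre inclusions by construction; the fibrewise rational `(p,p)` clause transports to every abelian presentation
`B ≅ 𝒳_u` (`isRationalClass_map_iff_of_iso`, `isOfHodgeType_map_iff_of_iso`, `dim B = dim A` by `schemeDim_eq_holds`).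
[cite: Deligne1982HodgeCycles, Prop. 6.1] [cite: CharlesSchnell2014Notes, Thm. 11.5.11] [cite: MumfordAV1970, §22 (CM type)] -/
theorem cmAnchoredFamilies_of_cmDense (h : CMDenseMumfordTateFamilies) : CMAnchoredFamilies := by
  intro A p c hc hpp
  obtain ⟨𝒳, S, f, s₁, e, W, hf, hQ𝒳, hQS, hirr, hsm, _, hW, hWc, hD⟩ :=
    h A (AbelianVariety.isSmoothProjective_holds (A := A)) p c hc hpp
  haveI : Nonempty (ComplexPoints S) := ⟨s₁⟩
  obtain ⟨s₀, A₀, ⟨e₀⟩, _, hcm₀⟩ := hD.nonempty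
  refine ⟨S, 𝒳, f, W, s₁, s₀, e.hom ≫ fiberι f s₁, A₀, e₀.hom ≫ fiberι f s₀, hQ𝒳, hQS, hsm, hirr, hf,
    ⟨e, rfl⟩, ⟨e₀, rfl⟩, (isCM_iff_exists_cmSubalgebra A₀).2 hcm₀, ?_, ?_⟩
  · rw [complexBetti.map_comp, CategoryTheory.comp_apply]
    exact hWc
  · rintro B eB u ⟨j, rfl⟩
    rw [complexBetti.map_comp, CategoryTheory.comp_apply]
    have hBdim : B.dim = A.dim := schemeDim_eq_holds ((hf.isSmoothProjective u).of_iso j.symm)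
    refine ⟨(isRationalClass_map_iff_of_iso j).2 (hW u).1, ?_⟩
    rw [hBdim]
    exact (isOfHodgeType_map_iff_of_iso j).2 (hW u).2

/-- **(B) The CM-pivot's anchor node is implied by the refereed Literature fact** (Deligne 1982 Prop. 6.1 in the
dense form of Charles–Schnell Thm. 11.5.11, the tree's `Deligne1982.deligne1982_cmDenseMumfordTateFamilies`), through
part III's `Iff.rfl` bridge and (A). A THEOREM IN PRINT enters as a HYPOTHESIS (named fact), as everywhere in the cell.
[cite: CharlesSchnell2014Notes, Thm. 11.5.11 and its proof (quasi-projectivity of the base by Cattani–Deligne–Kaplan)]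
[cite: Deligne1982HodgeCycles, Prop. 6.1] -/
theorem cmAnchoredFamilies_of_deligne1982 (h : deligne1982_cmDenseMumfordTateFamilies) : CMAnchoredFamilies :=
  cmAnchoredFamilies_of_cmDense (cmDenseMumfordTateFamilies_of_deligne1982 h)

/-! ## §B The anchor node implies the one-CM-fibre node, modulo Catanese's theorem -/

/-- **(C) `CMAnchoredFamilies ⟹ MumfordTateCMAnchors` modulo the printed fact
`Motives.catanese2002_abelianFibres_of_abelianFibre`** (every fibre of the family through `A ≅ 𝒳_t` is charted by an
abelian variety of dimension `dim A` — the clause `MumfordTateCMAnchors` demands at every fibre and `CMAnchoredFamilies`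
does not state; Catanese's theorem needs exactly the quasi-projectivity, smoothness and irreducibility clauses that
`CMAnchoredFamilies` carries). The fibrewise `(p,p)` clause at `𝒳_s` is read off the abelian chart `A' ≅ 𝒳_s` by
iso-transport; `dim A₀ = dim A` by `schemeDim_eq_holds`; the CM typings agree by `isCM_iff_exists_cmSubalgebra`.
The converse is not proved here (no quasi-projectivity in `MumfordTateCMAnchors`); it is derived modulo Raynaud 1970
by ring2-b01, `Ring2.Hypotheses.cmAnchoredFamilies_of_mumfordTateCMAnchors_of_raynaud1970` (module docstring, honest
column (1), rev 2). [cite: Catanese2002DeformationTypes, Thm. 4.1 and Thm. 4.6]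
[cite: Deligne1982HodgeCycles, Prop. 6.1] [cite: MumfordAV1970, §22 (CM type)] -/
theorem mumfordTateCMAnchors_of_cmAnchoredFamilies (hCat : catanese2002_abelianFibres_of_abelianFibre)
    (h : CMAnchoredFamilies) : MumfordTateCMAnchors := by
  intro A _ p c hc hpp
  obtain ⟨S, 𝒳, f, G, t, s₀, e, A₀, e₀, hQ𝒳, hQS, hsm, hirr, hf, ⟨i, rfl⟩, ⟨i₀, rfl⟩, hcm, hGc, hHA⟩ :=
    h A p c hc hpp
  have hab : ∀ s : ComplexPoints S, ∃ A' : AbelianVariety ℂ, A'.dim = A.dim ∧ Nonempty (A'.X ≅ fiberOver f s) :=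
    hCat f A hQ𝒳 hQS hirr hsm hf ⟨t, ⟨i⟩⟩
  have hW : ∀ s : ComplexPoints S, IsRationalClass (complexBetti.map (fiberι f s) (2 * p) G) ∧
      IsOfHodgeType A.dim (fiberOver f s) (2 * p) p p (complexBetti.map (fiberι f s) (2 * p) G) := by
    intro s
    obtain ⟨A', hdim', ⟨j⟩⟩ := hab s
    have h' := hHA A' (j.hom ≫ fiberι f s) s ⟨j, rfl⟩
    rw [complexBetti.map_comp, CategoryTheory.comp_apply, hdim'] at h'
    exact ⟨(isRationalClass_map_iff_of_iso j).1 h'.1, (isOfHodgeType_map_iff_of_iso j).1 h'.2⟩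
  have hdim₀ : A₀.dim = A.dim := schemeDim_eq_holds ((hf.isSmoothProjective s₀).of_iso i₀.symm)
  rw [complexBetti.map_comp, CategoryTheory.comp_apply] at hGc
  exact ⟨𝒳, S, f, t, s₀, i, G, A₀, hf, hirr, hsm, hab, hW, hGc, hdim₀, ⟨i₀⟩,
    (isCM_iff_exists_cmSubalgebra A₀).1 hcm⟩

/-- … hence the dense node reaches part I's one-CM-fibre node THROUGH the CM-pivot's anchor node as well (part II-b's
direct `mumfordTateCMAnchors_of_cmDense` needs no Catanese fact: the dense node states the abelian charts itself).
[cite: Deligne1982HodgeCycles, Prop. 6.1] [cite: Catanese2002DeformationTypes, Thm. 4.1 and Thm. 4.6] -/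
theorem mumfordTateCMAnchors_of_cmDense_via_cmAnchoredFamilies
    (hCat : catanese2002_abelianFibres_of_abelianFibre) (h : CMDenseMumfordTateFamilies) : MumfordTateCMAnchors :=
  mumfordTateCMAnchors_of_cmAnchoredFamilies hCat (cmAnchoredFamilies_of_cmDense h)

/-! ## §C The CM pivot with its anchor child discharged to print -/

/-- **(D) `HC_CM ∧ LocalVHCAtCM ∧ [Deligne 1982 Prop. 6.1, dense form] ⟹ HC_AV`.** The hypotheses layer's CM-pivot
composition `hc_av_of_hc_cm_of_cmAnchoredFamilies_of_localVHCAtCM` (local-to-global along the irreducible base: the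
algebraicity locus is a countable union of closed algebraic subsets, by relative Hilbert schemes — the argument of
Charles–Schnell's proof of Prop. 11.3.11; sorry-free in the tree) with its anchor input `CMAnchoredFamilies` supplied
by the refereed fact through (B). `HC_CM` is an explicit hypothesis, consumed at the CM fibre; `LocalVHCAtCM` (the
variational Hodge conjecture as a germ at a CM fibre of an abelian family) is OPEN and is the residual content. A
research route conditional on `HC_CM`; not a corollary. [cite: Deligne1982HodgeCycles, Prop. 6.1 and Thm. 2.12]
[cite: CharlesSchnell2014Notes, Conj. 11.3.1, proof of Prop. 11.3.11, and Thm. 11.5.11] -/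
theorem hc_av_of_hc_cm_of_localVHCAtCM_of_deligne1982 (hD : deligne1982_cmDenseMumfordTateFamilies)
    (hCM : Theses.RankFourFaces.CMAbelianHodge) (hV : LocalVHCAtCM) :
    Theses.PadicSemiregularLift.HodgeAbelianVarieties :=
  Ring2.Hypotheses.hc_av_of_hc_cm_of_cmAnchoredFamilies_of_localVHCAtCM hCM (cmAnchoredFamilies_of_deligne1982 hD) hV

/-- **(D′) Item 16267 from the germ-VHC alone, granted print: `LocalVHCAtCM ∧ [fact] ⟹ CMToAbelian`.**
[cite: Deligne1982HodgeCycles, Prop. 6.1] [cite: CharlesSchnell2014Notes, proof of Prop. 11.3.11 and Thm. 11.5.11] -/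
theorem cmToAbelian_of_localVHCAtCM_of_deligne1982 (hD : deligne1982_cmDenseMumfordTateFamilies)
    (hV : LocalVHCAtCM) : Theses.RankFourFaces.CMToAbelian :=
  Ring2.Hypotheses.cmToAbelian_of_cmAnchoredFamilies_of_localVHCAtCM (cmAnchoredFamilies_of_deligne1982 hD) hV

/-- **(D″) Fact-free form over the deform axis's own node: `HC_CM ∧ CMDenseMumfordTateFamilies ∧ LocalVHCAtCM ⟹ HC_AV`.**
[cite: Deligne1982HodgeCycles, Prop. 6.1] [cite: CharlesSchnell2014Notes, proof of Prop. 11.3.11 and Thm. 11.5.11] -/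
theorem hc_av_of_hc_cm_of_cmDense_of_localVHCAtCM (hCM : Theses.RankFourFaces.CMAbelianHodge)
    (hMT : CMDenseMumfordTateFamilies) (hV : LocalVHCAtCM) : Theses.PadicSemiregularLift.HodgeAbelianVarieties :=
  Ring2.Hypotheses.hc_av_of_hc_cm_of_cmAnchoredFamilies_of_localVHCAtCM hCM (cmAnchoredFamilies_of_cmDense hMT) hV

end Summit.HodgeConjecture.HodgeConjecture.Ring2.Deform

end
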